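import Summits.CriticalPhenomena.PercolationContinuityZ3.Theorems.PercNearOneGluingNoHeavyLowerTailAntitheticEarSpanBoxes
import HarnessLib

/-!
# `NoHeavyLowerTail` (stmt-CriticalPhenomena-4575) — antithetic cluster pairs: the CYCLE + EAR box scheme, P BEYOND THE EAR
# (cells of THEOREM Θ², HOME/MEMO-gen63.md §3; prim-hp-2 gen 63)

Support file (`--supports stmt-CriticalPhenomena-4575`, hull-port prover `prim-hp-2`, gen 63).  No definitions, no named facts, no sorries;
standard axioms.  Setting of …AntitheticEarTools / …EarSpanBoxes: cycle `v 0 = s, …, v n = v 0` (`n ≥ 3`), ear `u 0 = v α, …, u ℓ = v β`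
(`ℓ ≥ 1`, fresh interior), `E = Cyc.edgeSet n v ∪ Cyc.edgeSet ℓ u`, `X T = openCluster (T ∩ E) (v 0)`.  Here `P = v p` lies BEYOND the
ear: `α < β ≤ p < n` (the far pole `P = v β` included), excluding the one non-decomposable configuration `α = 0 ∧ p = β` (ear from `s`
to `P`: three internally disjoint `s–P` paths).

THE BOXES (HOME/MEMO-gen63.md §3, machine-verified by lab/cycle_ear_scheme.py for all `n ≤ 9`): with `D = [p,n)` (the arc from `s` to `P`
avoiding the ear) and `O = [0,p)`:
* TOP — the pairs of `D` red;  CELL `k` (`p ≤ k < n`) — `edge v k` blue, the pairs `[0,k)` red (the blue pair of `D` nearest to `P`, `O` red);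
* FN `j k` (`1 ≤ α ≤ j < β`, `p ≤ k < n`) — ear red, pairs `[0,j) ∪ [β,k)` red, `edge v j`, `edge v k` blue (route `s → v α → ear → v β → P`;
  `j` = blue pair nearest to `v α` on `[α,β)`, `k` = blue pair nearest to `P` on `[p,n)`);
* FZ `j k` (`α = 0`, `j < β < p ≤ k < n`) — ear red, pairs `(j,k)` red, `edge v j`, `edge v k` blue (`j` = blue pair nearest to `v β` on
  `[0,β)`; with the ear AT `s` a blue pair at `s` would not be shielded, hence the other orientation).
This file: INSIDE for the new route (`Cyc.mem_X_ear_of_routeF`; TOP/CELL use `Cyc.mem_X_ear_of_hi/lo`) and the COVER (`Cyc.ear_far_cover`).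
Uniqueness and red domination: …AntitheticEarFarDom / …EarFar.
[cite: VandenbergHaggstromKahn2005, §1 p. 3 (open cluster `C_s`)]
-/

noncomputable section

namespace Summit.CriticalPhenomena.PercolationContinuityZ3.Theorems

open Literature.Probability.Percolation
open scoped Classical

namespace Antithetic

namespace Cyc

variable {V : Type*} {n : ℕ} {v : ℕ → V} {ℓ : ℕ} {u : ℕ → V} {α β p : ℕ}

/-- **Inside, route F**: `[0,α)` red, ear red, `[β,p)` red (`s → v α → ear → v β → P`, `β ≤ p`). [this work] -/
theorem mem_X_ear_of_routeF (hβp : β ≤ p) (hpn : p < n) (hαβ : α ≤ β) (hu0 : u 0 = v α) (huℓ : u ℓ = v β) (T : Set (Sym2 V))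
    (hpre : ∀ i, i < α → edge v i ∈ T) (hear : ∀ m, m < ℓ → edge u m ∈ T) (hpost : ∀ i, β ≤ i → i < p → edge v i ∈ T) :
    v p ∈ openCluster (T ∩ (edgeSet n v ∪ edgeSet ℓ u)) (v 0) := by
  have h1 := reach_chain (T ∩ (edgeSet n v ∪ edgeSet ℓ u)) v (Nat.zero_le α)
    fun i _ hi => ⟨hpre i hi, Or.inl ⟨i, by omega, rfl⟩⟩
  have h2 := reach_chain (T ∩ (edgeSet n v ∪ edgeSet ℓ u)) u (Nat.zero_le ℓ)
    fun m _ hm => ⟨hear m hm, Or.inr ⟨m, hm, rfl⟩⟩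
  have h3 := reach_chain (T ∩ (edgeSet n v ∪ edgeSet ℓ u)) v hβp
    fun i hβi hip => ⟨hpost i hβi hip, Or.inl ⟨i, by omega, rfl⟩⟩
  rw [hu0, huℓ] at h2
  exact (h1.trans h2).trans h3

/-- **Cover (P beyond the ear).**  If `P = v p ∈ X T` (`α < β ≤ p < n`, not `α = 0 ∧ p = β`) then `T` lies in TOP, in some CELL `k`,
in some FN `j k` (when `α ≥ 1`) or in some FZ `j k` (when `α = 0`). [this work] -/
theorem ear_far_cover (hn : 3 ≤ n) (hinj : ∀ i j, i < n → j < n → v i = v j → i = j) (hper : v n = v 0) (hℓ : 1 ≤ ℓ)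
    (hαβ : α < β) (hβp : β ≤ p) (hpn : p < n) (hexc : ¬ (α = 0 ∧ p = β)) (hu0 : u 0 = v α) (huℓ : u ℓ = v β)
    (hfresh : ∀ j, 0 < j → j < ℓ → ∀ i, i ≤ n → u j ≠ v i) (huinj : ∀ i j, i ≤ ℓ → j ≤ ℓ → u i = u j → i = j)
    (T : Set (Sym2 V)) (hP : v p ∈ openCluster (T ∩ (edgeSet n v ∪ edgeSet ℓ u)) (v 0)) :
    (∀ i, p ≤ i → i < n → edge v i ∈ T) ∨
    (∃ k, p ≤ k ∧ k < n ∧ edge v k ∉ T ∧ ∀ i, i < k → edge v i ∈ T) ∨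
    (∃ j k, 1 ≤ α ∧ α ≤ j ∧ j < β ∧ p ≤ k ∧ k < n ∧ edge v j ∉ T ∧ edge v k ∉ T ∧
      (∀ i, i < n → (i < j ∨ (β ≤ i ∧ i < k)) → edge v i ∈ T) ∧ ∀ m, m < ℓ → edge u m ∈ T) ∨
    (∃ j k, α = 0 ∧ j < β ∧ β < p ∧ p ≤ k ∧ k < n ∧ edge v j ∉ T ∧ edge v k ∉ T ∧
      (∀ i, i < n → (j < i ∧ i < k) → edge v i ∈ T) ∧ ∀ m, m < ℓ → edge u m ∈ T) := by
  by_cases hD : ∀ i, p ≤ i → i < n → edge v i ∈ T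
  · exact Or.inl hD
  right
  -- `k₀`: the blue pair of `[p,n)` nearest to `P`
  obtain ⟨k₀, hpk₀, hk₀n, hk₀, hk₀red⟩ := near_lo v T hD
  by_cases hO : ∀ i, i < p → edge v i ∈ T
  · exact Or.inl ⟨k₀, hpk₀, hk₀n, hk₀, fun i hik => if hip : i < p then hO i hip else hk₀red i (by omega) hik⟩
  right
  -- `k₁`: the blue pair of `[0,p)` nearest to `P`
  obtain ⟨k₁, -, hk₁p, hk₁, hk₁red⟩ := near_hi v T (a := 0) (b := p) fun h => hO fun i hi => h i (Nat.zero_le i) hi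
  -- the common contradiction: a closed set through `P` avoiding `s`
  have key : ∀ (I J : ℕ → Prop), I p → ¬ I 0 → ¬ I n →
      (∀ i, i < n → (I i ↔ I (i + 1)) ∨ edge v i ∉ T ∩ (edgeSet n v ∪ edgeSet ℓ u)) →
      (∀ j, 0 < j → j + 1 < ℓ → (J j ↔ J (j + 1)) ∨ edge u j ∉ T ∩ (edgeSet n v ∪ edgeSet ℓ u)) →
      (2 ≤ ℓ → (I α ↔ J 1) ∨ edge u 0 ∉ T ∩ (edgeSet n v ∪ edgeSet ℓ u)) →
      (2 ≤ ℓ → (J (ℓ - 1) ↔ I β) ∨ edge u (ℓ - 1) ∉ T ∩ (edgeSet n v ∪ edgeSet ℓ u)) →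
      (ℓ = 1 → (I α ↔ I β) ∨ edge u 0 ∉ T ∩ (edgeSet n v ∪ edgeSet ℓ u)) → False := by
    intro I J hIp hI0 hIn hcyc hearI hearA hearB hearC
    have hcl := ear_closed_of_idx hn hinj hper hℓ (by omega : α ≤ n) (by omega : β < n) hu0 huℓ hfresh huinj
      (T ∩ (edgeSet n v ∪ edgeSet ℓ u)) Set.inter_subset_right I J
      ⟨fun h => absurd h hI0, fun h => absurd h hIn⟩ hcyc hearI hearA hearB hearC
    refine not_mem_cluster_of_closed (T ∩ (edgeSet n v ∪ edgeSet ℓ u)) (v 0) (v p) _ ?_ ?_ hcl hP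
    · exact (mem_idxSet_v hinj hper hn hfresh I J ⟨fun h => absurd h hI0, fun h => absurd h hIn⟩ (by omega : p ≤ n)).2 hIp
    · exact fun h => hI0 ((mem_idxSet_v hinj hper hn hfresh I J ⟨fun h => absurd h hI0, fun h => absurd h hIn⟩ (Nat.zero_le n)).1 h)
  have blue_of : ∀ {i : ℕ}, edge v i ∉ T → edge v i ∉ T ∩ (edgeSet n v ∪ edgeSet ℓ u) := fun h h' => h h'.1
  have blue_of' : ∀ {m : ℕ}, edge u m ∉ T → edge u m ∉ T ∩ (edgeSet n v ∪ edgeSet ℓ u) := fun h h' => h h'.1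
  by_cases hE : ∀ m, m < ℓ → edge u m ∈ T
  · -- the ear is red
    by_cases hF : (∀ i, i < α → edge v i ∈ T) ∧ (∀ i, β ≤ i → i < p → edge v i ∈ T)
    · -- the middle arc `[α,β)` has a blue pair (else `[0,p)` would be red)
      have hmid : ¬ ∀ i, α ≤ i → i < β → edge v i ∈ T := by
        intro h
        refine hO fun i hi => ?_
        by_cases h1 : i < α
        · exact hF.1 i h1
        by_cases h2 : i < β
        · exact h i (by omega) h2
        · exact hF.2 i (by omega) hi
      by_cases hα0 : α = 0
      · -- FZ: `j` = the blue pair nearest to `v β` on `[0,β)`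
        obtain ⟨j, -, hjβ, hj, hjred⟩ := near_hi v T hmid
        refine Or.inr ⟨j, k₀, hα0, hjβ, by omega, hpk₀, hk₀n, hj, hk₀, fun i hin ⟨hji, hik⟩ => ?_, hE⟩
        by_cases h1 : i < β
        · exact hjred i hji h1
        by_cases h2 : i < p
        · exact hF.2 i (by omega) h2
        · exact hk₀red i (by omega) hik
      · -- FN: `j` = the blue pair nearest to `v α` on `[α,β)`
        obtain ⟨j, hαj, hjβ, hj, hjred⟩ := near_lo v T hmid
        refine Or.inl ⟨j, k₀, by omega, hαj, hjβ, hpk₀, hk₀n, hj, hk₀, fun i hin hor => ?_, hE⟩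
        rcases hor with hij | ⟨hβi, hik⟩
        · by_cases h1 : i < α
          · exact hF.1 i h1
          · exact hjred i (by omega) hij
        · by_cases h2 : i < p
          · exact hF.2 i hβi h2
          · exact hk₀red i (by omega) hik
    -- otherwise `P ∉ X`: contradiction
    exfalso
    by_cases hG : ∀ i, β ≤ i → i < p → edge v i ∈ T
    · -- `[β,p)` red, so `[0,α)` is not red (and `α ≥ 1`); `k₁ < β`
      have hA : ¬ ∀ i, i < α → edge v i ∈ T := fun h => hF ⟨h, hG⟩
      have hk₁β : k₁ < β := by
        by_contra h
        exact hk₁ (hG k₁ (by omega) hk₁p)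
      by_cases hk₁α : α ≤ k₁
      · -- two intervals: `(k₁, k₀]` through `P` and `v β`, `(k₂, k₃]` through `v α`
        obtain ⟨k₂, -, hk₂α, hk₂, hk₂red⟩ := near_hi v T (a := 0) (b := α) fun h => hA fun i hi => h i (Nat.zero_le i) hi
        obtain ⟨k₃, hαk₃, hk₃p, hk₃, hk₃red⟩ :=
          near_lo v T (a := α) (b := p) fun h => hk₁ (h k₁ hk₁α hk₁p)
        have hk₃k₁ : k₃ ≤ k₁ := by
          by_contra h
          exact hk₁ (hk₃red k₁ hk₁α (by omega))
        refine key (fun i => (k₁ < i ∧ i ≤ k₀) ∨ (k₂ < i ∧ i ≤ k₃)) (fun _ => True) (Or.inl ⟨hk₁p, hpk₀⟩) (by omega) (by omega)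
          (fun i hin => ?_) (fun _ _ _ => Or.inl Iff.rfl) (fun _ => Or.inl ?_) (fun _ => Or.inl ?_) (fun _ => Or.inl ?_)
        · by_cases h1 : i = k₁
          · exact Or.inr (h1 ▸ blue_of hk₁)
          by_cases h2 : i = k₀
          · exact Or.inr (h2 ▸ blue_of hk₀)
          by_cases h3 : i = k₂
          · exact Or.inr (h3 ▸ blue_of hk₂)
          by_cases h4 : i = k₃
          · exact Or.inr (h4 ▸ blue_of hk₃)
          exact Or.inl (by constructor <;> intro h <;> omega)
        · exact ⟨fun _ => trivial, fun _ => Or.inr ⟨hk₂α, hαk₃⟩⟩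
        · exact ⟨fun _ => Or.inl ⟨hk₁β, by omega⟩, fun _ => trivial⟩
        · exact ⟨fun _ => Or.inl ⟨hk₁β, by omega⟩, fun _ => Or.inr ⟨hk₂α, hαk₃⟩⟩
      · -- one interval `(k₁, k₀]` containing both ends of the ear
        push Not at hk₁α
        refine key (fun i => k₁ < i ∧ i ≤ k₀) (fun _ => True) ⟨hk₁p, hpk₀⟩ (by omega) (by omega)
          (fun i hin => ?_) (fun _ _ _ => Or.inl Iff.rfl) (fun _ => Or.inl ?_) (fun _ => Or.inl ?_) (fun _ => Or.inl ?_)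
        · by_cases h1 : i = k₁
          · exact Or.inr (h1 ▸ blue_of hk₁)
          by_cases h2 : i = k₀
          · exact Or.inr (h2 ▸ blue_of hk₀)
          exact Or.inl (by constructor <;> intro h <;> omega)
        · exact ⟨fun _ => trivial, fun _ => ⟨hk₁α, by omega⟩⟩
        · exact ⟨fun _ => ⟨hk₁β, by omega⟩, fun _ => trivial⟩
        · exact ⟨fun _ => ⟨hk₁β, by omega⟩, fun _ => ⟨hk₁α, by omega⟩⟩
    · -- `[β,p)` has a blue pair, so `β ≤ k₁`: the ear avoids the red segment `(k₁, k₀]` of `P`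
      have hβk₁ : β ≤ k₁ := by
        by_contra h
        exact hG fun i hβi hip => hk₁red i (by omega) hip
      refine key (fun i => k₁ < i ∧ i ≤ k₀) (fun _ => False) ⟨hk₁p, hpk₀⟩ (by omega) (by omega)
        (fun i hin => ?_) (fun _ _ _ => Or.inl Iff.rfl) (fun _ => Or.inl ?_) (fun _ => Or.inl ?_) (fun _ => Or.inl ?_)
      · by_cases h1 : i = k₁
        · exact Or.inr (h1 ▸ blue_of hk₁)
        by_cases h2 : i = k₀
        · exact Or.inr (h2 ▸ blue_of hk₀)
        exact Or.inl (by constructor <;> intro h <;> omega)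
      · exact ⟨fun h => absurd h.1 (by omega), fun h => h.elim⟩
      · exact ⟨fun h => h.elim, fun h => absurd h.1 (by omega)⟩
      · exact ⟨fun h => absurd h.1 (by omega), fun h => absurd h.1 (by omega)⟩
  · -- the ear has a blue pair `m`
    push Not at hE
    obtain ⟨m, hmℓ, hm⟩ := hE
    exfalso
    refine key (fun i => k₁ < i ∧ i ≤ k₀) (fun j => (j ≤ m ∧ k₁ < α) ∨ (m < j ∧ k₁ < β)) ⟨hk₁p, hpk₀⟩ (by omega) (by omega)
      (fun i hin => ?_) (fun j hj0 hj1 => ?_) (fun hℓ2 => ?_) (fun hℓ2 => ?_) (fun hℓ1 => ?_)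
    · by_cases h1 : i = k₁
      · exact Or.inr (h1 ▸ blue_of hk₁)
      by_cases h2 : i = k₀
      · exact Or.inr (h2 ▸ blue_of hk₀)
      exact Or.inl (by constructor <;> intro h <;> omega)
    · by_cases hjm : j = m
      · exact Or.inr (hjm ▸ blue_of' hm)
      · exact Or.inl (by constructor <;> intro h <;> omega)
    · by_cases hm0 : m = 0
      · exact Or.inr (hm0 ▸ blue_of' hm)
      · exact Or.inl (by constructor <;> intro h <;> omega)
    · by_cases hm1 : m = ℓ - 1
      · exact Or.inr (hm1 ▸ blue_of' hm)
      · exact Or.inl (by constructor <;> intro h <;> omega)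
    · have hm0 : m = 0 := by omega
      exact Or.inr (hm0 ▸ blue_of' hm)

end Cyc

end Antithetic

end Summit.CriticalPhenomena.PercolationContinuityZ3.Theorems
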